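import Literature.Computability.Cryptography.HallgrenClassGroup
import Literature.Computability.Cryptography.HallgrenClassGroupQuantumKernel
import Literature.Computability.Cryptography.HallgrenClassGroupAssembly
import Literature.Computability.Cryptography.HallgrenClassGroupSingleClassOrder
import Literature.Computability.Cryptography.HallgrenClassGroupBlockFP
import Literature.Computability.Cryptography.SISOddPart
import Literature.Computability.Cryptography.ShorProofs
import Literature.Computability.Cryptography.ShorAssemblyLeavesProofs
import Literature.Computability.QuantumComplexity.CWrapAssembly
import HarnessLib

/-!
# Crux `ArithStatLadder.IqThreeMemBQP` (stmt-QuantumAdvantage-2424), line `scholz-mirror-siegel` — stub `stub_threeOrdBit` (S4a)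

Registered stub of the line skeleton `Cruxes/IqThreeMemBQP/Lines/scholz_mirror_siegel.lean` (reshape r5:
the signature below is stated over tree constants only and must stay BYTE-IDENTICAL to the registered
one — edit only the proof and add helper lemmas above it; adjust the imports freely).

Proof summary (plumbing over PROVED tree facts; no definition — every classical map is a typed `CodeFP`
composite built inside a proof). The hypothesis `Hallgren2005.subgroupOrder_qsolvable` gives a uniform
quantum family which, on an instance code `w = encodeClInstance d L` with `IsClInstance d L`, outputs with
probability `≥ 2/3` a string `y` having `bin (clGenOrder d L)` as a BARE PREFIX. ONE classical wrap
(`isQSolvable_classicalWrap_holds`, identity pre-processing) with the `FP` post-processor of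
`exists_threeOrdPost` turns it into a family writing the membership bit of `THREEORD` first on EVERY input,
and `mem_BQP_of_isQSolvable_bit` concludes. The post-processor (i) reads `x` as a one-form instance code,
RE-ENCODES and compares, and decides the promise `IsClInstance d [q]` on codes (`isPosPrimC`, `isReducedC`) —
answering `[false]` otherwise, whatever `y` is; (ii) DECODES THE BARE PREFIX BY VERIFICATION
(`orderRead_eq_orderOf`): among the `|y| + 1` candidates `n = ⟦y ↾ k⟧` it keeps those with `q^n ∼ 1`
(square-and-multiply `ClBlockFP.powG`/`powGC` of `HallgrenClassGroupBlockFP` and the identity test against the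
principal form, `powG_eq_one_iff`) and takes their `gcd`: every kept `n` is a multiple of `ord [q]`, and
`ord [q]` itself is kept whenever `bin (ord [q]) <+: y`, so the `gcd` is `ord [q] = clGenOrder d [q]`
(`clGenOrder_singleton`); it answers `[3 ∣ gcd]`.
-/

noncomputable section

namespace Summit.QuantumAdvantage.QuantumAdvantage.Theorems.ArithStatLadder.IqThreeMemBQP

open scoped NumberField nonZeroDivisors
open _root_.Computability Literature.Computability.Complexity Literature.Computability.Cryptography
open Literature.Computability.QuantumComplexity
open Literature.NumberTheory.QuadraticFields

/-! ## Helper lemmas -/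

section Helpers

open Literature.Computability.Complexity.CodeFP Literature.Computability.Complexity.Brick Polynomial
open Literature.Computability.Cryptography.Hallgren2005 Hallgren2005.ClFP Hallgren2005.ClBlockFP Hallgren2005.OrderCl
  Hallgren2005.FormComposition
open Literature.NumberTheory.QuadraticFields.Quadratic (BinQF)

/-! ### Order read-out by verification (generic over the form class group; the `gcd`-fold lemmas are the
tree's `SIS.foldl_gcd_dvd` / `SIS.dvd_foldl_gcd`) -/

/-- **The identity test**: the square-and-multiply power `powG D f n` of a primitive positive definite form
is the principal form iff `[f]^n = 1` (both sides are reduced, `classOf'_inj`). [folklore] -/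
theorem powG_eq_one_iff (Δ : NegDiscr) {f : BinQF} (hf : f.IsPosPrim Δ.D) (n : ℕ) :
    powG Δ.D f n = one Δ.D ↔ classOf' Δ f ^ n = 1 := by
  obtain ⟨p1, p2, p3⟩ := powG_spec Δ hf.emod_four hf n
  obtain ⟨o1, o2⟩ := isPosPrim_one Δ.neg hf.emod_four
  refine ⟨fun h => ?_, fun h => classOf'_inj Δ p1 o1 p2 o2 ?_⟩
  · rw [← p3, h, classOf'_one Δ hf.emod_four]
  · rw [p3, h, classOf'_one Δ hf.emod_four]

/-- **Order read-out by verification.** If `bin (ord [f])` is a prefix of `y`, the `gcd` of those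
candidates `n = ⟦y ↾ k⟧` (`k ≤ |y|`) that pass the identity test `powG D f n = one D` is `ord [f]`: every
passing candidate is a multiple of the order, and the order is a passing candidate. [folklore] -/
theorem orderRead_eq_orderOf (Δ : NegDiscr) {f : BinQF} (hf : f.IsPosPrim Δ.D) {y : List Bool}
    (hy : natE (orderOf (classOf' Δ f)) <+: y) :
    (((List.range (y.length + 1)).map fun k => bitsToNat (y.take k)).filter
        fun n => decide (powG Δ.D f n = one Δ.D)).foldl Nat.gcd 0 = orderOf (classOf' Δ f) := by
  refine Nat.dvd_antisymm ((SIS.foldl_gcd_dvd _ 0).2 _ (List.mem_filter.2 ⟨?_, ?_⟩))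
    (SIS.dvd_foldl_gcd _ 0 (dvd_zero _) ?_)
  · refine List.mem_map.2 ⟨(natE (orderOf (classOf' Δ f))).length,
      List.mem_range.2 (Nat.lt_succ_of_le hy.length_le), ?_⟩
    rw [← List.prefix_iff_eq_take.1 hy, bitsToNat_natE]
  · rw [decide_eq_true_eq, powG_eq_one_iff Δ hf, pow_orderOf_eq_one]
  · intro n hn
    rw [orderOf_dvd_iff_pow_eq_one, ← powG_eq_one_iff Δ hf]
    exact of_decide_eq_true (List.mem_filter.1 hn).2

/-- The candidates `⟦y ↾ k⟧`, `k = 0, …, |y|`, on codes. [folklore] -/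
private theorem candsC : CodeFP strE (rawE natE) fun y => (List.range (y.length + 1)).map fun k => bitsToNat (y.take k) := by
  have hy : CodeFP (pairE strE natE) strE (fun p => p.1) := fst _ _
  have hitem := strVal.comp (strTake.comp ((unOfNatMin.comp ((strLength.comp hy).pair (snd _ _))).pair hy))
  have h := (map hitem).comp ((CodeFP.id strE).pair (urange.comp (unSucc.comp strLength)))
  refine h.congr fun y => List.map_congr_left fun k _ => ?_
  rw [id, ← List.take_take, List.take_length]

/-- The `gcd` of a raw list of numerals, on codes (the fold divides a nonzero item or vanishes, so its
code is no longer than the list's). [folklore] -/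
private theorem gcdFoldC : CodeFP (rawE natE) natE fun l => l.foldl Nat.gcd 0 := by
  have hgcd : CodeFP (pairE natE natE) natE (fun p => Nat.gcd p.2 p.1) :=
    (natGcdABC.comp ((snd _ _).pair (fst _ _))).fst'
  refine (foldl₀ (step := fun a b => Nat.gcd b a) (b₀ := 0) hgcd X fun l₁ l₂ => ?_).congr fun _ => rfl
  show (natE (l₁.foldl (fun b a => Nat.gcd b a) 0)).length ≤ X.eval (rawE natE (l₁ ++ l₂)).length
  rw [eval_X]
  by_cases h : ∀ n ∈ l₁, n = 0
  · have h0 : l₁.foldl (fun b a => Nat.gcd b a) 0 = 0 :=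
      Nat.eq_zero_of_zero_dvd (SIS.dvd_foldl_gcd l₁ 0 (dvd_refl 0) fun n hn => by simp [h n hn])
    rw [h0]
    exact Nat.zero_le _
  · simp only [not_forall, exists_prop] at h
    obtain ⟨n, hn, hn0⟩ := h
    have hdvd : l₁.foldl (fun b a => Nat.gcd b a) 0 ∣ n := (SIS.foldl_gcd_dvd l₁ 0).2 n hn
    have h1 := length_item_le_length_rawE natE (List.mem_append_left l₂ hn)
    have h2 : (natE (l₁.foldl (fun b a => Nat.gcd b a) 0)).length ≤ (natE n).length :=
      length_encodeNat_mono (Nat.le_of_dvd (Nat.pos_of_ne_zero hn0) hdvd)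
    omega

/-- **The order read-out on codes**: `(D, f, y) ↦ gcd {⟦y ↾ k⟧ : powG D f ⟦y ↾ k⟧ = one D}`.
[folklore] -/
theorem orderReadC : CodeFP (pairE (pairE intE formE) strE) natE fun p =>
    (((List.range (p.2.length + 1)).map fun k => bitsToNat (p.2.take k)).filter
      fun n => decide (powG p.1.1 p.1.2 n = one p.1.1)).foldl Nat.gcd 0 := by
  have hD : CodeFP (pairE (pairE intE formE) natE) intE (fun t => t.1.1) := (fst _ _).fst'
  have htest := (eq formE_injective).comp
    ((powGC.comp (hD.pair ((fst _ _).snd'.pair (snd _ _)))).pair (oneC.comp hD))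
  exact (gcdFoldC.comp ((filter htest).comp ((fst _ _).pair (candsC.comp (snd _ _))))).congr fun _ => rfl

/-- Gauss reducedness (`|b| ≤ a ≤ c`, and `b ≥ 0` if `|b| = a` or `a = c`) decided on codes. [folklore] -/
theorem isReducedC : CodeFP formE bitE (fun f => decide f.IsReduced) := by
  have ha := aC
  have hb := bC
  have hab := intAbs.comp hb
  have h := (intLe.comp (hab.pair ha)).and ((intLe.comp (ha.pair cC)).and
    ((((intEq.comp (hab.pair ha)).or (intEq.comp (ha.pair cC))).not).or (intLe.comp ((const formE (0 : ℤ)).pair hb))))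
  refine h.congr fun f => ?_
  rw [Bool.eq_iff_iff]
  simp only [Bool.and_eq_true, Bool.or_eq_true, Bool.not_eq_true', Bool.or_eq_false_iff, decide_eq_true_eq,
    decide_eq_false_iff_not, BinQF.IsReduced, imp_iff_not_or, not_or]

/-! ### The instance checker and the post-processor -/

/-- The instance format transported to forms, on codes: `q = (a, b, c) ↦ toForm q`. [folklore] -/
private theorem toFormC : CodeFP (pairE natE (pairE intE natE)) formE toForm :=
  (mkFormC.comp ((intOfNat.comp (fst _ _)).pair ((snd _ _).fst'.pair (intOfNat.comp (snd _ _).snd')))).congr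
    fun _ => rfl

/-- Reading the fields of a one-form instance code: on `encodeClInstance d [q]` the string bricks return
`d` and the three coefficients of `q`. [folklore] -/
private theorem fields_encodeClInstance (d : ℕ) (q : ℕ × ℤ × ℕ) :
    (bitsToNat (fstF (encodeClInstance d [q])),
      (bitsToNat (fstF (fstF (sndF (encodeClInstance d [q])))),
        (ival (fstF (sndF (fstF (sndF (encodeClInstance d [q]))))),
          bitsToNat (sndF (sndF (fstF (sndF (encodeClInstance d [q])))))))) = (d, q) := by
  obtain ⟨a, b, c⟩ := q
  simp [encodeClInstance, formCode, encList_cons]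

/-- The promise `IsClInstance d [q]` as a conjunction of decidable tests. [folklore] -/
private theorem isClInstance_singleton_iff (d : ℕ) (q : ℕ × ℤ × ℕ) :
    IsClInstance d [q] ↔ 0 < d ∧ ((-(d : ℤ)) % 4 = 0 ∨ (-(d : ℤ)) % 4 = 1) ∧
      (toForm q).IsPosPrim (-(d : ℤ)) ∧ (toForm q).IsReduced := by
  simp only [IsClInstance, List.mem_singleton, forall_eq]

/-- **The post-processor** (`FP`). On `⟨x, y⟩` it (i) reads `x` as a one-form instance code
`⟨bin d, ⟨⟨bin a, ⟨dp b, bin c⟩⟩, ε⟩⟩`, checks that `x` IS that code (re-encode and compare) and that the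
promise `IsClInstance d [(a, b, c)]` holds — otherwise it answers `[false]`, whatever `y` is; (ii) computes
the order read-out of `y` for `(−d, toForm q)` (`orderReadC`) and answers `[3 ∣ it]`. On an instance and an
output `y` carrying `bin (clGenOrder d [q])` as a prefix the answer is `[3 ∣ clGenOrder d [q]]`
(`orderRead_eq_orderOf`, `clGenOrder_singleton`). [folklore] -/
private theorem exists_threeOrdPost : ∃ g : List Bool → List Bool, g ∈ FP ∧
    (∀ (d : ℕ) (q : ℕ × ℤ × ℕ) (y : List Bool), IsClInstance d [q] →
      encodeNat (clGenOrder d [q]) <+: y →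
        g (boolPair (encodeClInstance d [q]) y) = [decide (3 ∣ clGenOrder d [q])]) ∧
    (∀ x y : List Bool, (¬ ∃ (d : ℕ) (q : ℕ × ℤ × ℕ), x = encodeClInstance d [q] ∧ IsClInstance d [q]) →
      g (boolPair x y) = [false]) := by
  -- the field decoder, the re-encoder, the promise, the post-processor
  set dec : List Bool → ℕ × ℕ × ℤ × ℕ := fun x => (bitsToNat (fstF x), (bitsToNat (fstF (fstF (sndF x))),
    (ival (fstF (sndF (fstF (sndF x)))), bitsToNat (sndF (sndF (fstF (sndF x))))))) with hdec
  set enc : ℕ × ℕ × ℤ × ℕ → List Bool := fun p => encodeClInstance p.1 [p.2] with henc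
  set prom : ℕ × ℕ × ℤ × ℕ → Bool := fun p => (decide (0 < p.1) && (decide (-(p.1 : ℤ) % 4 = 0) ||
    decide (-(p.1 : ℤ) % 4 = 1))) && (decide ((toForm p.2).IsPosPrim (-(p.1 : ℤ))) &&
      decide (toForm p.2).IsReduced) with hprom
  set post : List Bool × List Bool → Bool := fun p => (decide (p.1 = enc (dec p.1)) && prom (dec p.1)) &&
    decide ((((List.range (p.2.length + 1)).map fun k => bitsToNat (p.2.take k)).filter
      fun n => decide (powG (-((dec p.1).1 : ℤ)) (toForm (dec p.1).2) n = one (-((dec p.1).1 : ℤ)))).foldl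
        Nat.gcd 0 % 3 = 0) with hpost
  have hival : CodeFP strE intE ival := of_fn zcanonF zcanonF_mem_FP fun w => zcanonF_eq w
  have hdecC : CodeFP strE (pairE natE (pairE natE (pairE intE natE))) dec :=
    ((strVal.comp fstFC).pair ((strVal.comp (fstFC.comp (fstFC.comp sndFC))).pair
      ((hival.comp (fstFC.comp (sndFC.comp (fstFC.comp sndFC)))).pair
        (strVal.comp (sndFC.comp (sndFC.comp (fstFC.comp sndFC))))))).congr fun _ => rfl
  have hencC : CodeFP (pairE natE (pairE natE (pairE intE natE))) strE enc :=
    ((fst _ _).pair ((rawSingleton _).comp (snd _ _))).recodeOut fun _ => rfl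
  have hstrE : Function.Injective strE := fun _ _ h => h
  have hD : CodeFP (pairE natE (pairE natE (pairE intE natE))) intE (fun p => -(p.1 : ℤ)) :=
    intNeg.comp (intOfNat.comp (fst _ _))
  have hq : CodeFP (pairE natE (pairE natE (pairE intE natE))) formE (fun p => toForm p.2) :=
    toFormC.comp (snd _ _)
  have hpromC : CodeFP (pairE natE (pairE natE (pairE intE natE))) bitE prom := by
    have h0 : CodeFP (pairE natE (pairE natE (pairE intE natE))) intE (fun _ => (0 : ℤ)) := const _ 0
    have h4 : CodeFP (pairE natE (pairE natE (pairE intE natE))) intE (fun _ => (4 : ℤ)) := const _ 4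
    have hmod := intSub.comp (hD.pair (intMul.comp (h4.pair (intEDiv.comp (hD.pair h4)))))
    have h := ((natLt.comp ((const _ 0).pair (fst _ _))).and ((intEq.comp (hmod.pair h0)).or
      (intEq.comp (hmod.pair (const _ 1))))).and ((isPosPrimC.comp (hD.pair hq)).and (isReducedC.comp hq))
    refine h.congr fun p => ?_
    have hm : -(p.1 : ℤ) - 4 * (-(p.1 : ℤ) / 4) = -(p.1 : ℤ) % 4 := by omega
    simp only [hprom, hm]
  have hpostC : CodeFP (pairE strE strE) bitE post := by
    have hx : CodeFP (pairE strE strE) (pairE natE (pairE natE (pairE intE natE))) (fun p => dec p.1) :=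
      hdecC.comp (fst _ _)
    have hok := (eq hstrE).comp ((fst _ _).pair (hencC.comp hx))
    have hread := orderReadC.comp (((hD.comp hx).pair (hq.comp hx)).pair (snd _ _))
    have h3 := natEq.comp ((natMod.comp (hread.pair (const _ 3))).pair (const _ 0))
    exact ((hok.and (hpromC.comp hx)).and h3).congr fun _ => rfl
  -- the specification
  have hprom_iff : ∀ p : ℕ × ℕ × ℤ × ℕ, prom p = true ↔ IsClInstance p.1 [p.2] := fun p => by
    rw [isClInstance_singleton_iff]
    simp only [hprom, Bool.and_eq_true, Bool.or_eq_true, decide_eq_true_eq, and_assoc]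
  have hdec_enc : ∀ (d : ℕ) (q : ℕ × ℤ × ℕ), dec (encodeClInstance d [q]) = (d, q) := fun d q => by
    rw [hdec]; exact fields_encodeClInstance d q
  obtain ⟨g, hg, hgs⟩ := hpostC
  refine ⟨g, hg, fun d q y hinst hy => ?_, fun x y hx => ?_⟩
  · have hgxy : g (boolPair (encodeClInstance d [q]) y) = [post (encodeClInstance d [q], y)] :=
      hgs (encodeClInstance d [q], y)
    rw [hgxy]
    congr 1
    have hf : (toForm q).IsPosPrim (negDiscrOf hinst.1).D := (hinst.2.2 q (List.mem_singleton_self q)).1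
    rw [clGenOrder_singleton hinst] at hy ⊢
    have hread : (((List.range (y.length + 1)).map fun k => bitsToNat (y.take k)).filter
        fun n => decide (powG (-(d : ℤ)) (toForm q) n = one (-(d : ℤ)))).foldl Nat.gcd 0 =
          orderOf (classOf' (negDiscrOf hinst.1) (toForm q)) :=
      orderRead_eq_orderOf (negDiscrOf hinst.1) hf hy
    simp only [hpost, hdec_enc, henc, decide_true, (hprom_iff (d, q)).2 hinst, Bool.true_and, hread,
      Nat.dvd_iff_mod_eq_zero]
  · have hgxy : g (boolPair x y) = [post (x, y)] := hgs (x, y)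
    rw [hgxy]
    congr 1
    rw [Bool.eq_false_iff]
    intro h
    simp only [hpost, Bool.and_eq_true, decide_eq_true_eq] at h
    exact hx ⟨(dec x).1, (dec x).2, h.1.1, (hprom_iff (dec x)).1 h.1.2⟩

end Helpers

/-! ## The registered stub (signature verbatim) -/

/-- **S4a `stub_threeOrdBit`.** The one-bit order oracle of the imaginary side as an honest LANGUAGE:
`THREEORD = {encodeClInstance d [q] : IsClInstance d [q] ∧ 3 ∣ clGenOrder d [q]}` (`clGenOrder d [q]` = the
order of the class of the reduced form `q` in `Cl(−d)`, ANY negative discriminant,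
`Hallgren2005.clGenOrder_singleton`) is in `BQP`, GIVEN the named fact `Hallgren2005.subgroupOrder_qsolvable`
([Kitaev1995, §3–§4]; [Hallgren2005, §4]: the order of the subgroup generated by given forms, bare-prefix
output). Proof: ONE `isQSolvable_classicalWrap_holds` around that family with identity pre-processing and
the `FP` post-processor of `exists_threeOrdPost` — instance checker (re-encode and compare, `IsClInstance`
decided on codes) and DECODING BY VERIFICATION of the bare-prefix answer: the `gcd` of the candidate prefixes
`n = ⟦y ↾ k⟧` with `q^n ∼ 1` (square-and-multiply `ClBlockFP.powG` and the identity test against the principal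
form) is `ord [q] = clGenOrder d [q]` whenever `bin (ord [q]) <+: y` (probability `≥ 2/3`), and the output bit
is `[3 ∣ gcd]`; off the valid instance codes the answer is `[false]` for every `y`. So the wrapped family
writes the membership bit of `THREEORD` first on EVERY input, and `mem_BQP_of_isQSolvable_bit` (decision
from search, with the discharged Born rule `QCircuit.outputPMF_apply_holds` and unitarity
`cliffordT_isUnitary_holds`) concludes. -/
theorem stub_threeOrdBit :
    Hallgren2005.subgroupOrder_qsolvable →
      ({w : List Bool | ∃ (d : ℕ) (q : ℕ × ℤ × ℕ), w = Hallgren2005.encodeClInstance d [q] ∧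
        Hallgren2005.IsClInstance d [q] ∧ 3 ∣ Hallgren2005.clGenOrder d [q]} : Language Bool) ∈ BQP := by
  classical
  intro hS
  obtain ⟨g, hg, hyes, hno⟩ := exists_threeOrdPost
  have hwrap := isQSolvable_classicalWrap_holds (fun w => w) g (PolyTimeComputable.id _) hg hS
  set L : Language Bool := {w : List Bool | ∃ (d : ℕ) (q : ℕ × ℤ × ℕ), w = Hallgren2005.encodeClInstance d [q] ∧
    Hallgren2005.IsClInstance d [q] ∧ 3 ∣ Hallgren2005.clGenOrder d [q]}
  have hbit : IsQSolvable fun x => {z | [decide (x ∈ L)] <+: z} := by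
    refine hwrap.mono fun x z hz => ?_
    obtain ⟨y, hy, hz⟩ := hz
    simp only [Set.mem_setOf_eq] at hy ⊢
    by_cases hx : ∃ (d : ℕ) (q : ℕ × ℤ × ℕ), x = Hallgren2005.encodeClInstance d [q] ∧ Hallgren2005.IsClInstance d [q]
    · obtain ⟨d, q, rfl, hinst⟩ := hx
      rw [hyes d q y hinst (hy d [q] rfl hinst)] at hz
      have hmem : Hallgren2005.encodeClInstance d [q] ∈ L ↔ 3 ∣ Hallgren2005.clGenOrder d [q] := by
        change (∃ (d' : ℕ) (q' : ℕ × ℤ × ℕ), Hallgren2005.encodeClInstance d [q] = Hallgren2005.encodeClInstance d' [q'] ∧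
          Hallgren2005.IsClInstance d' [q'] ∧ 3 ∣ Hallgren2005.clGenOrder d' [q']) ↔ _
        constructor
        · rintro ⟨d', q', he, -, h3⟩
          obtain ⟨rfl, hl⟩ := Hallgren2005.encodeClInstance_inj he
          obtain rfl : q = q' := List.singleton_inj.1 hl
          exact h3
        · exact fun h3 => ⟨d, q, rfl, hinst, h3⟩
      rw [decide_eq_decide.2 hmem]
      exact hz
    · rw [hno x y hx] at hz
      have hmem : ¬ x ∈ L := fun ⟨d, q, he, hinst, _⟩ => hx ⟨d, q, he, hinst⟩
      rw [decide_eq_false hmem]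
      exact hz
  exact mem_BQP_of_isQSolvable_bit (fun _ _ => QCircuit.outputPMF_apply_holds) cliffordT_isUnitary_holds
    (fun x => decide_eq_true_iff) hbit

end Summit.QuantumAdvantage.QuantumAdvantage.Theorems.ArithStatLadder.IqThreeMemBQP

end
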